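import Summits.HodgeConjecture.HodgeConjecture.Theorems.F0P3SpectralPacketXiEvp   -- ★ (N) FILE 3s: `piXiS`∕`rhoXiS` read-backs, the POINTWISE engine `GlobalPacket.evpAtψ_eq_eigencharacter_of_mem` (h4 AT v), `mem_piXiS_fin_iff`, `mem_xiH_rhoXiS_iff`
import HarnessLib

/-!
# (N) FILE 3s″ — (P2a) e.v.p. READ-BACKS WITH THE UNRAMIFIED-MEMBER LAW (ℓ4) READ ONLY OFF `S₀` (F13 «JQ-RAM» WP1, ref4 R4-175's missing item «XiEvpG»: additive `_offS` siblings of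
# ★ 3s `F0P3SpectralPacketXiEvp` :152 `evpGψ_piXiS_eq_of_not_mem` and :230 `evpHψ_rhoXiS_eq_of_not_mem`) (Rogawski §13.7 pp. 210–212; §13.3 p. 203 l. 1–3; §12.2 p. 174 l. 1)

Cell `hodgecm-mathlib` (D-0151), F0∕P3 «U3-mult», crux H413 (`stmt-HodgeConjecture-24833`), route of record `HCCMUnconditional`; programme R90-TF, F13 «JQ-RAM» repair
(director M-159∕M-159b; heir LEAD F0P3a-plan (g22) T21-11 WP1 + T21-13 (1) §3′ r2; R90-TF LEAD K2E1-plan (g8) LEAD #38 F13-SCOPE memo 7a2d5558a063a1f1 + LEAD #39 (A) r2;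
ref4 (g13) R4-175 «F13 BLAST RADIUS BY KERNEL» 2026-09-04T23:39:39Z: «XI-EVP: `XiEvp.evpHψ_rhoXiS_eq_of_not_mem` (junction-DIRECT, `UnramLaw` + `UnrDefLaw` global) ⇢
`evpAtψ_eq_eigencharacter_of_mem` — not in WP1's list: add `XiEvpG` (1 head) or the junction ED. 6 cannot hand it the guarded token»; LH7-typ1 (g3) census `F13-LEAF-USESITES.v1` §3
«XiEvp :164 :243 S₀-contextual»).  Seat: S7 prover R90-C146-p01 (g2).  PROOF lane (`--kind proof --supports stmt-HodgeConjecture-24833 --as helper`): theorems only; no `def`, no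
instance, no notation, no named fact, no `sorry`; never imports a `Cruxes/…/Lines` module; ★ 3s UNTOUCHED (rule 69: siblings; T-B :268–:276 keeps reading ★ 3s until ED. 6).

WHY (F13).  Under (R-39)″ the letter's law (KG1) becomes (KG1′) `∀ v, Algebra.IsUnramifiedIn (𝓞 L) v.asIdeal → (𝔩 v).UnramLaw`, uninhabitable kit-wide (J-RAM-3); the junction
T-B reads ★ 3s :230 at :269 ∕ :275 with the WHOLE `h4 : ∀ v, (𝔩 v).UnramLaw` (and :152's G-side sibling `evpGψ_eq_of_not_mem` per place), always AT `v ∉ Sψ ∪ S₉ ⊇ S₀`.  The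
★ heads carry the binder `S₀` (`hψK : ∀ v ∉ S₀`, `hv₀ : v ∉ S₀`) and conclude at the single place `v` (`S₀`-free) ⇒ §3′ r2 shape: `h4 : ∀ v ∉ S₀, (𝔩 v).UnramLaw` bound right
AFTER `hψK`, application `(h4 v)` ↦ `(h4 v hv₀)`; (KG2) `h9 : ∀ v, UnrDefLaw (𝔩 v)` stays GLOBAL and unguarded (F13-SCOPE §1).  The engine ★ `evpAtψ_eq_eigencharacter_of_mem`
already takes (ℓ4) AT `v` — no engine twin needed.  Caller (T-B ED. 6): `h4 := fun v hv => hKG1′ v (hS v hv)` with the junction's `hS : ∀ v ∉ S, Algebra.IsUnramifiedIn (𝓞 L) v.asIdeal`.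

CONTENTS.  §1 `SpectralPacketG.evpGψ_piXiS_eq_of_not_mem_offS` (twin of ★ 3s :152) · §2 `SpectralPacketH.evpHψ_rhoXiS_eq_of_not_mem_offS` (twin of ★ 3s :230, the T-B :269 ∕ :275 head).

HONEST LABEL: count-neutral repair twins; they pay no socket and no citation and nothing on the counted path until the F13 window is BUILT.  HC_CM is proved only modulo the 7
printed citations (2 remaining named inputs: hLiu418 = stmt-HodgeConjecture-24832, h413 = stmt-HodgeConjecture-24833) until rung 0 closes; STANDING DEFECT M-159∕M-159b «JQ-RAM».

References: [Rogawski1990] §13.7 pp. 210–212, §13.3 p. 199 ¶2, p. 203 l. 1–3, §13.1 Prop. 13.1.3 (d) p. 199, §12.2 p. 174 l. 1, §14.2 p. 232; [CartierCorvallis1979] §IV.1 Cor. 4.1.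
-/

set_option autoImplicit false
-- the mandated namespace repeats `HodgeConjecture.HodgeConjecture`, as in every `Theorems/*.lean` of this sub-problem
set_option linter.dupNamespace false

noncomputable section

open NumberField IsDedekindDomain MeasureTheory Filter
open scoped Matrix MatrixGroups

open Literature.NumberTheory Literature.NumberTheory.Automorphic Literature.NumberTheory.Automorphic.UnitaryGroup
open Literature.NumberTheory.Rogawski1990 Literature.NumberTheory.GaloisRepresentations
open Literature.RepresentationTheory.BorelWallach2000 Literature.RepresentationTheory.KonnoKonno2007
open Summit.HodgeConjecture.HodgeConjecture.Cruxes.H413.F0P3InnerFormClassificationV6 (TestG splitForm)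
open Summit.HodgeConjecture.HodgeConjecture.Cruxes.H413.F0P3LocalPacketKit
open Summit.HodgeConjecture.HodgeConjecture.Cruxes.H413.F0P3ArchPacketKit

/-! ## §1 (P2a)-G e.v.p. read-back, (ℓ4) off `S₀` [§13.7 pp. 210–212; §12.2 p. 174 l. 1] -/

namespace Summit.HodgeConjecture.HodgeConjecture.Cruxes.H413.F0P3SpectralPacket.SpectralPacketG

open Summit.HodgeConjecture.HodgeConjecture.Cruxes.H413.F0P3GlobalPacket

variable {L : Type} [Field L] [NumberField L] [IsCMField L] {H : Matrix (Fin 3) (Fin 3) L}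
  {𝔩 : ∀ v : HeightOneSpectrum (𝓞 ↥(maximalRealSubfield L)), LocalPacketKit L (splitForm L 3) v} {𝔞 : ArchPacketKit}
  {μ : Measure (adelicGroupData (↥(maximalRealSubfield L)) L (IsCMField.complexConj L) 3 (splitForm L 3)).automorphicQuotient}
  [SMulInvariantMeasure (adelicGroupData (↥(maximalRealSubfield L)) L (IsCMField.complexConj L) 3 (splitForm L 3)).Adelic
    (adelicGroupData (↥(maximalRealSubfield L)) L (IsCMField.complexConj L) 3 (splitForm L 3)).automorphicQuotient μ]
  {Pk' : OneDimAutRepH L → ∀ v : HeightOneSpectrum (𝓞 ↥(maximalRealSubfield L)), CMLocalAPacket L H v}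
  {PkInf : OneDimAutRepH L → LocalAPacket (GKIrrClass (uFormGroup (Fin 2) (Fin 1)))} {κ : OneDimAutRepH L → ℤ}
  {ram : OneDimAutRepH L → Finset (HeightOneSpectrum (𝓞 ↥(maximalRealSubfield L)))}
  [∀ v : HeightOneSpectrum (𝓞 ↥(maximalRealSubfield L)), MeasurableSpace ((cmDatum L 3 (splitForm L 3)).Local v)]
  [∀ v : HeightOneSpectrum (𝓞 ↥(maximalRealSubfield L)), BorelSpace ((cmDatum L 3 (splitForm L 3)).Local v)]
  [∀ v : HeightOneSpectrum (𝓞 ↥(maximalRealSubfield L)), MeasurableSpace ((cmDatum L 3 H).Local v)]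
  [∀ v : HeightOneSpectrum (𝓞 ↥(maximalRealSubfield L)), BorelSpace ((cmDatum L 3 H).Local v)]
  {νG' : ∀ v : HeightOneSpectrum (𝓞 ↥(maximalRealSubfield L)), Measure ((cmDatum L 3 H).Local v)}
  [∀ v, (νG' v).IsMulLeftInvariant] [∀ v, IsFiniteMeasureOnCompacts (νG' v)]

/-- **(s2) (P2a)-G, e.v.p., (ℓ4) READ OFF `S₀`** (twin of ★ 3s `evpGψ_piXiS_eq_of_not_mem`): `evpG (PiXi ξ) v = tXi ξ v` off `S₀ ∪ ram ξ` — the tuple's slot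
`(piXiS h ξ).evpGψ ψ (ψ_* ν′) v` IS the record's `t(ξ)_v := πⁿ(ξ_v).eigencharacter K′_v ν′_v`, modulo (ℓ4) OFF `S₀` (`h4 : ∀ v ∉ S₀, (𝔩 v).UnramLaw`, bound right after `hψK`),
(ℓ9) global, `ψ_v(K′_v) = K_v` off `S₀`, sphericity and admissibility of the record's `πⁿ(ξ_v)`.  Binder order: `ψ h h9 S₀ hψK h4 hsph hadm ξ hv₀ hv`.
[cite: Rogawski1990, §13.7 pp. 210–212; §12.2 p. 174 l. 1; §13.3 p. 203 l. 1–3] [cite: CartierCorvallis1979, §IV.1 Cor. 4.1] -/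
theorem evpGψ_piXiS_eq_of_not_mem_offS
    (ψ : ∀ v : HeightOneSpectrum (𝓞 ↥(maximalRealSubfield L)), (cmDatum L 3 H).Local v ≃ₜ* (cmDatum L 3 (splitForm L 3)).Local v)
    (h : XiPacketsSigned 𝔩 𝔞 μ (transportAPackets ψ Pk') PkInf κ)
    (h9 : ∀ v : HeightOneSpectrum (𝓞 ↥(maximalRealSubfield L)), UnrDefLaw (𝔩 v))
    (S₀ : Finset (HeightOneSpectrum (𝓞 ↥(maximalRealSubfield L))))
    (hψK : ∀ v ∉ S₀, (cmLocalIntegralLevel L 3 H v).map (ψ v : (cmDatum L 3 H).Local v →* (cmDatum L 3 (splitForm L 3)).Local v) =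
      cmLocalIntegralLevel L 3 (splitForm L 3) v)
    (h4 : ∀ v ∉ S₀, (𝔩 v).UnramLaw)
    (hsph : ∀ (ξ : OneDimAutRepH L), ∀ v ∉ ram ξ, (Pk' ξ v).πn.IsSpherical (cmLocalIntegralLevel L 3 H v))
    (hadm : ∀ (ξ : OneDimAutRepH L) (v : HeightOneSpectrum (𝓞 ↥(maximalRealSubfield L))), (Pk' ξ v).πn.IsAdmissible)
    (ξ : OneDimAutRepH L) {v : HeightOneSpectrum (𝓞 ↥(maximalRealSubfield L))} (hv₀ : v ∉ S₀) (hv : v ∉ ram ξ) :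
    (piXiS h ξ).evpGψ ψ (fun w => (νG' w).map (ψ w)) v = (Pk' ξ v).πn.eigencharacter (cmLocalIntegralLevel L 3 H v) (νG' v) := by
  rw [evpGψ_eq_evpAtψ]
  exact (piXiS h ξ).fin.evpAtψ_eq_eigencharacter_of_mem ψ νG' (h4 v hv₀) (h9 v) (hψK v hv₀) (hadm ξ v) (hsph ξ v hv)
    (((mem_piXiS_fin_iff h ξ v _).2 (Or.inl rfl)))

end Summit.HodgeConjecture.HodgeConjecture.Cruxes.H413.F0P3SpectralPacket.SpectralPacketG

/-! ## §2 (P2a)-H e.v.p. read-back, (ℓ4) off `S₀` — the T-B :269 ∕ :275 head [Prop. 13.1.3 (d); §13.7 pp. 210–212] -/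

namespace Summit.HodgeConjecture.HodgeConjecture.Cruxes.H413.F0P3SpectralPacket.SpectralPacketH

open Summit.HodgeConjecture.HodgeConjecture.Cruxes.H413.F0P3GlobalPacket

variable {L : Type} [Field L] [NumberField L] [IsCMField L] {H : Matrix (Fin 3) (Fin 3) L}
  {𝔩 : ∀ v : HeightOneSpectrum (𝓞 ↥(maximalRealSubfield L)), LocalPacketKit L (splitForm L 3) v} {𝔞 : ArchPacketKit} {𝔞H : ArchPacketKitH 𝔞}
  {DiscH : GlobalPacketH 𝔩 → 𝔞H.PktInfH → Prop}
  {Pk' : OneDimAutRepH L → ∀ v : HeightOneSpectrum (𝓞 ↥(maximalRealSubfield L)), CMLocalAPacket L H v}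
  {PkInf : OneDimAutRepH L → LocalAPacket (GKIrrClass (uFormGroup (Fin 2) (Fin 1)))}
  {χ : OneDimAutRepH L → ∀ v : HeightOneSpectrum (𝓞 ↥(maximalRealSubfield L)),
    (UnitaryGroup.cmDatum L 2 (Matrix.of fun i j : Fin 2 => if i.val + j.val + 1 = 2 then (1 : L) else 0)).Local v ×
      (UnitaryGroup.cmDatum L 1 (Matrix.of fun i j : Fin 1 => if i.val + j.val + 1 = 1 then (1 : L) else 0)).Local v →* ℂˣ}
  {hχ : ∀ (ξ : OneDimAutRepH L) (v : HeightOneSpectrum (𝓞 ↥(maximalRealSubfield L))),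
    IsOpen (((χ ξ v).ker : Subgroup ((UnitaryGroup.cmDatum L 2 (Matrix.of fun i j : Fin 2 => if i.val + j.val + 1 = 2 then (1 : L) else 0)).Local v ×
      (UnitaryGroup.cmDatum L 1 (Matrix.of fun i j : Fin 1 => if i.val + j.val + 1 = 1 then (1 : L) else 0)).Local v)) :
      Set ((UnitaryGroup.cmDatum L 2 (Matrix.of fun i j : Fin 2 => if i.val + j.val + 1 = 2 then (1 : L) else 0)).Local v ×
        (UnitaryGroup.cmDatum L 1 (Matrix.of fun i j : Fin 1 => if i.val + j.val + 1 = 1 then (1 : L) else 0)).Local v))}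
  {ε : OneDimAutRepH L → HeightOneSpectrum (𝓞 ↥(maximalRealSubfield L)) → ℤ} {κH : OneDimAutRepH L → ℤ}
  {ram : OneDimAutRepH L → Finset (HeightOneSpectrum (𝓞 ↥(maximalRealSubfield L)))}
  [∀ v : HeightOneSpectrum (𝓞 ↥(maximalRealSubfield L)), MeasurableSpace ((cmDatum L 3 (splitForm L 3)).Local v)]
  [∀ v : HeightOneSpectrum (𝓞 ↥(maximalRealSubfield L)), BorelSpace ((cmDatum L 3 (splitForm L 3)).Local v)]
  [∀ v : HeightOneSpectrum (𝓞 ↥(maximalRealSubfield L)), MeasurableSpace ((cmDatum L 3 H).Local v)]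
  [∀ v : HeightOneSpectrum (𝓞 ↥(maximalRealSubfield L)), BorelSpace ((cmDatum L 3 H).Local v)]
  {νG' : ∀ v : HeightOneSpectrum (𝓞 ↥(maximalRealSubfield L)), Measure ((cmDatum L 3 H).Local v)}
  [∀ v, (νG' v).IsMulLeftInvariant] [∀ v, IsFiniteMeasureOnCompacts (νG' v)]

/-- **(s4) (P2a)-H, e.v.p., (ℓ4) READ OFF `S₀`** (twin of ★ 3s `evpHψ_rhoXiS_eq_of_not_mem`, the head T-B reads WHOLE at :269 ∕ :275): `evpH (ρXi ξ) v = tXi ξ v` off `S₀ ∪ ram ξ`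
(«`t(Π(ρ)) = ξ_H(t(ρ))`», here `Π(ξ) = ξ_H(ξ)`): the tuple's slot `(rhoXiS h ξ).evpHψ ψ (ψ_* ν′) v` IS the record's `t(ξ)_v`, modulo (ℓ4) OFF `S₀` (`h4 : ∀ v ∉ S₀, (𝔩 v).UnramLaw`,
right after `hψK`), (ℓ9) global, `ψ_v(K′_v) = K_v` off `S₀`, sphericity and admissibility of the record's `πⁿ(ξ_v)`.  Binder order: `ψ h h9 S₀ hψK h4 hsph hadm ξ hv₀ hv`; T-B ED. 6
:269 ∕ :275 call `evpHψ_rhoXiS_eq_of_not_mem_offS 𝔨.ψ hXiHS h9 (Sψ ∪ S₉) hψK (fun v hv => hKG1′ v (hS v hv)) hsph hadmn ξ …`.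
[cite: Rogawski1990, §13.7 pp. 210–212; §13.1 Prop. 13.1.3 (d) p. 199; §12.2 p. 174 l. 1] [cite: CartierCorvallis1979, §IV.1 Cor. 4.1] -/
theorem evpHψ_rhoXiS_eq_of_not_mem_offS
    (ψ : ∀ v : HeightOneSpectrum (𝓞 ↥(maximalRealSubfield L)), (cmDatum L 3 H).Local v ≃ₜ* (cmDatum L 3 (splitForm L 3)).Local v)
    (h : XiHPacketsSigned 𝔩 𝔞 𝔞H DiscH (transportAPackets ψ Pk') PkInf χ hχ ε κH)
    (h9 : ∀ v : HeightOneSpectrum (𝓞 ↥(maximalRealSubfield L)), UnrDefLaw (𝔩 v))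
    (S₀ : Finset (HeightOneSpectrum (𝓞 ↥(maximalRealSubfield L))))
    (hψK : ∀ v ∉ S₀, (cmLocalIntegralLevel L 3 H v).map (ψ v : (cmDatum L 3 H).Local v →* (cmDatum L 3 (splitForm L 3)).Local v) =
      cmLocalIntegralLevel L 3 (splitForm L 3) v)
    (h4 : ∀ v ∉ S₀, (𝔩 v).UnramLaw)
    (hsph : ∀ (ξ : OneDimAutRepH L), ∀ v ∉ ram ξ, (Pk' ξ v).πn.IsSpherical (cmLocalIntegralLevel L 3 H v))
    (hadm : ∀ (ξ : OneDimAutRepH L) (v : HeightOneSpectrum (𝓞 ↥(maximalRealSubfield L))), (Pk' ξ v).πn.IsAdmissible)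
    (ξ : OneDimAutRepH L) {v : HeightOneSpectrum (𝓞 ↥(maximalRealSubfield L))} (hv₀ : v ∉ S₀) (hv : v ∉ ram ξ) :
    (rhoXiS h ξ).evpHψ ψ (fun w => (νG' w).map (ψ w)) v = (Pk' ξ v).πn.eigencharacter (cmLocalIntegralLevel L 3 H v) (νG' v) := by
  funext f
  change (rhoXiS h ξ).imageG.evpAtψ ψ (fun w => (νG' w).map (ψ w)) v f = _
  rw [(rhoXiS h ξ).imageG.evpAtψ_eq_eigencharacter_of_mem ψ νG' (h4 v hv₀) (h9 v) (hψK v hv₀) (hadm ξ v) (hsph ξ v hv)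
    (((mem_xiH_rhoXiS_iff h ξ v _).2 (Or.inl rfl)))]

end Summit.HodgeConjecture.HodgeConjecture.Cruxes.H413.F0P3SpectralPacket.SpectralPacketH

end
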